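import Summits.CriticalPhenomena.CardyFormulaZ2.Theorems.CardyAnchoredRigiditySubseqCardyRectDuality
import Summits.CriticalPhenomena.CardyFormulaZ2.Theorems.CardyAnchoredRigiditySubseqCardyReduction
import Summits.CriticalPhenomena.CardyFormulaZ2.Theorems.CardyAnchoredRigiditySubseqCardyLatticeSubmult

/-!
# Joint sequential limits on the boxes `(0,w) × (0,1)` crossed left-to-right: strict monotonicity,
# sub-multiplicativity, exponential decay and continuity in the aspect ratio
# (crux `SubseqCardy`, stmt-CriticalPhenomena-5768, line `registered`, lead c5: kernel facts, part 2)

Route `CardyAnchoredRigidity` (decl shared with `CardyLocalRigidity`), sub-problem `CardyFormulaZ2`.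
For a JOINT SEQUENTIAL LIMIT (`u → 0⁺`, `g`) of the bond-`ℤ²` crossing probabilities (the object of
S2/S3) write `ℓ(w) = g (L_w)` for any conformal rectangle `L_w` with carrier `(0,w) × (0,1)`, arc `0`
its left side and arc `2` its right side (such `L_w` exist, `exists_lrBox`; the value only depends on
carrier and arcs, `JointLimit.congr`). Unconditionally (no conformal invariance, no DKKMO):

* `JointLimit.lr_antitone` — `ℓ` is non-increasing;
* `JointLimit.lr_submul` — **`ℓ(w₁ + w₂) ≤ ℓ(w₁) ℓ(w₂)`**: at the fitted meshes `1/m` the three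
  values are EXACT lattice crossing probabilities `h(a, m - 2)` (`bond_lr_eq`) with
  `a(w₁ + w₂) ≥ a(w₁) + a(w₂) + 1`, and `h` is sub-multiplicative (`crossingProb_submultiplicative`,
  part 1: column cut + independence of disjoint edge sets);
* `JointLimit.lr_strictAnti` — `ℓ` is STRICTLY decreasing (`ℓ(w') ≤ ℓ(w) ℓ(w' - w) < ℓ(w)`, all
  values lying in `(0,1)` by RSW, `jointLimit_mem_Ioo`);
* `JointLimit.lr_le_half_pow`, `JointLimit.lr_eventually_le` — `ℓ(k + 1) ≤ 2^{-(k+1)}` (`ℓ(1) = 1/2`,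
  `lrSquare_eq_half`), so `ℓ(w) → 0` as `w → ∞`;
* `JointLimit.lr_continuous` — `ℓ` is continuous on `(0, ∞)` (the box of width `w` is the image of
  the box of width `w₀` under the axis stretch `x + iy ↦ (w/w₀) x + iy`, uniformly close to the identity
  near the box, and `g` is Schramm–Smirnov continuous, `JointLimit.abs_sub_map_le`).

Part 3 reads these through a sequential crossing KERNEL `f` (`ℓ(w) = f (η(w))`, `η` the strictly
decreasing rectangle modulus): `f` is strictly increasing and continuous on `(0,1)` with
`f(0⁺) = 0`, `f(1⁻) = 1`.

References: B. Bollobás, O. Riordan, *Percolation* (2006), Ch. 3 (Lemma 1, eq. (3)) and Ch. 7 §1;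
O. Schramm, S. Smirnov, Ann. Probab. 39 (2011) §5; G. Grimmett, *Percolation* (1999) §11.7.
-/

noncomputable section

namespace Summit.CriticalPhenomena.CardyFormulaZ2.Cruxes.SubseqCardy.Birth

open Set Filter Topology Metric
open Literature.Probability.RandomPlanarGeometry (ConformalRectangle MarkedDomain)
open Literature.Probability.LatticeModels
open Literature.Probability.Percolation (bondDomainCrossingProb crossingProb half crossingProb_anti_left
  crossingProb_mem_Icc)
open Summit.CriticalPhenomena.CardyFormulaZ2.Cruxes.SimilarityUpgrade.Stubs.RectangleDuality (bond_lr_eq)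

namespace JointLimit

variable {u : ℕ → ℝ} {g : ConformalRectangle → ℝ}

/-! ### Fitted meshes: the left-to-right box values are exact lattice crossing probabilities -/

/-- The fitted lattice sizes `⌊1/u n⌋₊` tend to infinity. [folklore] -/
theorem tendsto_meshFloor (hu : Tendsto u atTop (𝓝[>] (0 : ℝ))) :
    Tendsto (fun n => ⌊1 / u n⌋₊) atTop atTop := by
  have hu0 : Tendsto u atTop (𝓝 (0:ℝ)) := (tendsto_nhdsWithin_iff.1 hu).1
  have hupos : ∀ᶠ n in atTop, 0 < u n := (tendsto_nhdsWithin_iff.1 hu).2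
  refine tendsto_atTop.2 fun M => ?_
  have hsmall : ∀ᶠ n in atTop, u n < 1 / ((M:ℝ) + 1) := hu0.eventually (Iio_mem_nhds (by positivity))
  filter_upwards [hupos, hsmall] with n hn hns
  refine Nat.le_floor ?_
  have : (M:ℝ) + 1 ≤ 1 / u n := by
    rw [le_div_iff₀ hn]
    have := (lt_div_iff₀ (by positivity : (0:ℝ) < M + 1)).1 hns
    linarith
  linarith

/-- **At every large fitted mesh `1/m` the left-to-right crossing probability of the box
`(0,w) × (0,1)` IS a lattice crossing probability `h(a, m-2)` with `a + 1 < w m ≤ a + 2`, `a ≥ 1`**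
(`bond_lr_eq`). [folklore] -/
theorem eventually_lr_eq (hu : Tendsto u atTop (𝓝[>] (0 : ℝ))) {w : ℝ} (hw : 0 < w)
    (L : ConformalRectangle) (hLc : L.carrier = (Ioo (0:ℝ) w ×ℂ Ioo (0:ℝ) 1))
    (hL0 : L.arc 0 = {z : ℂ | z.re = 0 ∧ z.im ∈ Icc (0:ℝ) 1})
    (hL2 : L.arc 2 = {z : ℂ | z.re = w ∧ z.im ∈ Icc (0:ℝ) 1}) :
    ∀ᶠ n in atTop, ∃ a : ℕ, 1 ≤ a ∧ (a:ℝ) + 1 < w * ⌊1 / u n⌋₊ ∧ w * ⌊1 / u n⌋₊ ≤ a + 2 ∧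
      bondDomainCrossingProb L (1 / (⌊1 / u n⌋₊ : ℝ)) = crossingProb half a (⌊1 / u n⌋₊ - 2) := by
  obtain ⟨M, hM⟩ := exists_nat_gt (2 / w)
  filter_upwards [(tendsto_meshFloor hu).eventually_ge_atTop (max M 3)] with n hn
  set m : ℕ := ⌊1 / u n⌋₊ with hmdef
  have hm3 : 3 ≤ m := (le_max_right _ _).trans hn
  have hmM : M ≤ m := (le_max_left _ _).trans hn
  have hm0 : (0:ℝ) < m := by exact_mod_cast (by omega : 0 < m)
  have hwm : 2 < w * m := by
    have h1 : 2 / w < m := hM.trans_le (by exact_mod_cast hmM)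
    rw [div_lt_iff₀ hw] at h1
    linarith
  obtain ⟨a, ha, ha', ha1, ha2⟩ := exists_window_div (w := w) hm0 (by linarith)
  have h1a : 1 ≤ a := by
    have : (2:ℝ) < a + 2 := hwm.trans_le ha2
    have : (0:ℝ) < a := by linarith
    exact_mod_cast this
  exact ⟨a, h1a, ha1, ha2, bond_lr_eq L hLc hL0 hL2 (by positivity) ha ha' (fit_height (by omega)) h1a⟩

/-! ### Monotonicity and sub-multiplicativity in the width -/

/-- **The left-to-right box values of a joint limit are non-increasing in the width.**
[cite: BollobasRiordan2006, Ch. 3, proof of eq. (3)] -/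
theorem lr_antitone (hu : Tendsto u atTop (𝓝[>] (0 : ℝ)))
    (hg : ∀ R : ConformalRectangle, Tendsto (fun n => bondDomainCrossingProb R (u n)) atTop (𝓝 (g R)))
    {w w' : ℝ} (hw : 0 < w) (hww' : w ≤ w')
    (L : ConformalRectangle) (hLc : L.carrier = (Ioo (0:ℝ) w ×ℂ Ioo (0:ℝ) 1))
    (hL0 : L.arc 0 = {z : ℂ | z.re = 0 ∧ z.im ∈ Icc (0:ℝ) 1})
    (hL2 : L.arc 2 = {z : ℂ | z.re = w ∧ z.im ∈ Icc (0:ℝ) 1})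
    (L' : ConformalRectangle) (hLc' : L'.carrier = (Ioo (0:ℝ) w' ×ℂ Ioo (0:ℝ) 1))
    (hL0' : L'.arc 0 = {z : ℂ | z.re = 0 ∧ z.im ∈ Icc (0:ℝ) 1})
    (hL2' : L'.arc 2 = {z : ℂ | z.re = w' ∧ z.im ∈ Icc (0:ℝ) 1}) : g L' ≤ g L := by
  have hw' : 0 < w' := hw.trans_le hww'
  refine le_of_tendsto_of_tendsto (tendsto_fitted hu hg L') (tendsto_fitted hu hg L) ?_
  filter_upwards [eventually_lr_eq hu hw L hLc hL0 hL2, eventually_lr_eq hu hw' L' hLc' hL0' hL2']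
    with n hn hn'
  obtain ⟨a, -, ha1, ha2, he⟩ := hn
  obtain ⟨a', -, ha1', ha2', he'⟩ := hn'
  rw [he, he']
  refine crossingProb_anti_left half ?_ _
  have hm0 : (0:ℝ) ≤ ⌊1 / u n⌋₊ := Nat.cast_nonneg _
  have h1 : w * ⌊1 / u n⌋₊ ≤ w' * ⌊1 / u n⌋₊ := mul_le_mul_of_nonneg_right hww' hm0
  have h2 : (a:ℝ) + 1 < a' + 2 := by linarith
  have h3 : (a:ℝ) < a' + 1 := by linarith
  exact_mod_cast Nat.lt_succ_iff.1 (by exact_mod_cast h3 : a < a' + 1)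

/-- **Sub-multiplicativity of the left-to-right box values of a joint limit**:
`g (L_{w₁ + w₂}) ≤ g (L_{w₁}) · g (L_{w₂})`. [cite: BollobasRiordan2006, Ch. 3, proof of eq. (3)] -/
theorem lr_submul (hu : Tendsto u atTop (𝓝[>] (0 : ℝ)))
    (hg : ∀ R : ConformalRectangle, Tendsto (fun n => bondDomainCrossingProb R (u n)) atTop (𝓝 (g R)))
    {w₁ w₂ w : ℝ} (hw₁ : 0 < w₁) (hw₂ : 0 < w₂) (hw : w = w₁ + w₂)
    (L₁ : ConformalRectangle) (hLc₁ : L₁.carrier = (Ioo (0:ℝ) w₁ ×ℂ Ioo (0:ℝ) 1))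
    (hL0₁ : L₁.arc 0 = {z : ℂ | z.re = 0 ∧ z.im ∈ Icc (0:ℝ) 1})
    (hL2₁ : L₁.arc 2 = {z : ℂ | z.re = w₁ ∧ z.im ∈ Icc (0:ℝ) 1})
    (L₂ : ConformalRectangle) (hLc₂ : L₂.carrier = (Ioo (0:ℝ) w₂ ×ℂ Ioo (0:ℝ) 1))
    (hL0₂ : L₂.arc 0 = {z : ℂ | z.re = 0 ∧ z.im ∈ Icc (0:ℝ) 1})
    (hL2₂ : L₂.arc 2 = {z : ℂ | z.re = w₂ ∧ z.im ∈ Icc (0:ℝ) 1})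
    (L : ConformalRectangle) (hLc : L.carrier = (Ioo (0:ℝ) w ×ℂ Ioo (0:ℝ) 1))
    (hL0 : L.arc 0 = {z : ℂ | z.re = 0 ∧ z.im ∈ Icc (0:ℝ) 1})
    (hL2 : L.arc 2 = {z : ℂ | z.re = w ∧ z.im ∈ Icc (0:ℝ) 1}) : g L ≤ g L₁ * g L₂ := by
  have hw0 : 0 < w := by rw [hw]; positivity
  refine le_of_tendsto_of_tendsto (tendsto_fitted hu hg L)
    ((tendsto_fitted hu hg L₁).mul (tendsto_fitted hu hg L₂)) ?_
  filter_upwards [eventually_lr_eq hu hw₁ L₁ hLc₁ hL0₁ hL2₁, eventually_lr_eq hu hw₂ L₂ hLc₂ hL0₂ hL2₂,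
    eventually_lr_eq hu hw0 L hLc hL0 hL2] with n hn₁ hn₂ hn
  obtain ⟨a₁, -, h₁, h₁', he₁⟩ := hn₁
  obtain ⟨a₂, -, h₂, h₂', he₂⟩ := hn₂
  obtain ⟨a, -, h, h', he⟩ := hn
  simp only [he₁, he₂, he]
  have hsum : a₁ + a₂ + 1 ≤ a := by
    have e : w * ⌊1 / u n⌋₊ = w₁ * ⌊1 / u n⌋₊ + w₂ * ⌊1 / u n⌋₊ := by rw [hw]; ring
    have h3 : (a₁:ℝ) + a₂ + 2 < a + 2 := by linarith
    have h4 : (a₁:ℝ) + a₂ < a := by linarith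
    exact_mod_cast (by exact_mod_cast h4 : a₁ + a₂ < a)
  calc crossingProb half a (⌊1 / u n⌋₊ - 2)
      ≤ crossingProb half (a₁ + a₂ + 1) (⌊1 / u n⌋₊ - 2) := crossingProb_anti_left half hsum _
    _ ≤ crossingProb half a₁ (⌊1 / u n⌋₊ - 2) * crossingProb half a₂ (⌊1 / u n⌋₊ - 2) :=
        Lattice.crossingProb_add_succ_le_mul half a₁ a₂ _

/-- **The left-to-right box values of a joint limit are STRICTLY decreasing in the width**
(`g (L_{w'}) ≤ g (L_w) · g (L_{w' - w}) < g (L_w)`, all values in `(0,1)` by RSW).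
[cite: BollobasRiordan2006, Ch. 3, proof of eq. (3)] -/
theorem lr_strictAnti (hu : Tendsto u atTop (𝓝[>] (0 : ℝ)))
    (hg : ∀ R : ConformalRectangle, Tendsto (fun n => bondDomainCrossingProb R (u n)) atTop (𝓝 (g R)))
    {w w' : ℝ} (hw : 0 < w) (hww' : w < w')
    (L : ConformalRectangle) (hLc : L.carrier = (Ioo (0:ℝ) w ×ℂ Ioo (0:ℝ) 1))
    (hL0 : L.arc 0 = {z : ℂ | z.re = 0 ∧ z.im ∈ Icc (0:ℝ) 1})
    (hL2 : L.arc 2 = {z : ℂ | z.re = w ∧ z.im ∈ Icc (0:ℝ) 1})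
    (L' : ConformalRectangle) (hLc' : L'.carrier = (Ioo (0:ℝ) w' ×ℂ Ioo (0:ℝ) 1))
    (hL0' : L'.arc 0 = {z : ℂ | z.re = 0 ∧ z.im ∈ Icc (0:ℝ) 1})
    (hL2' : L'.arc 2 = {z : ℂ | z.re = w' ∧ z.im ∈ Icc (0:ℝ) 1}) : g L' < g L := by
  have hd : 0 < w' - w := by linarith
  obtain ⟨L'', hc'', h0'', h2''⟩ := exists_lrBox (w' - w) hd
  have hsub := lr_submul hu hg hw hd (by ring : w' = w + (w' - w)) L hLc hL0 hL2 L'' hc'' h0'' h2''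
    L' hLc' hL0' hL2'
  have hL := jointLimit_mem_Ioo hu hg L
  have hL'' := jointLimit_mem_Ioo hu hg L''
  calc g L' ≤ g L * g L'' := hsub
    _ < g L * 1 := mul_lt_mul_of_pos_left hL''.2 hL.1
    _ = g L := mul_one _

/-! ### Exponential decay of long left-to-right crossings -/

/-- **`g (L_{k+1}) ≤ 2^{-(k+1)}`**: the unit square has value `1/2` (`lrSquare_eq_half`) and the box
values are sub-multiplicative. [cite: BollobasRiordan2006, Ch. 3, Lemma 1 and proof of eq. (3)] -/
theorem lr_le_half_pow (hu : Tendsto u atTop (𝓝[>] (0 : ℝ)))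
    (hg : ∀ R : ConformalRectangle, Tendsto (fun n => bondDomainCrossingProb R (u n)) atTop (𝓝 (g R)))
    (k : ℕ) (L : ConformalRectangle) (hLc : L.carrier = (Ioo (0:ℝ) ((k:ℝ) + 1) ×ℂ Ioo (0:ℝ) 1))
    (hL0 : L.arc 0 = {z : ℂ | z.re = 0 ∧ z.im ∈ Icc (0:ℝ) 1})
    (hL2 : L.arc 2 = {z : ℂ | z.re = (k:ℝ) + 1 ∧ z.im ∈ Icc (0:ℝ) 1}) : g L ≤ (1 / 2) ^ (k + 1) := by
  induction k generalizing L with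
  | zero =>
    simp only [Nat.cast_zero, zero_add] at hLc hL2
    rw [zero_add, pow_one]
    refine (lrSquare_eq_half hu hg one_pos L (x₀ := 0) (y₀ := 0) (by simpa using hLc) (by simpa using hL0)
      (by simpa using hL2)).le
  | succ k ih =>
    obtain ⟨Lk, hck, h0k, h2k⟩ := exists_lrBox ((k:ℝ) + 1) (by positivity)
    obtain ⟨L₁, hc₁, h0₁, h2₁⟩ := exists_lrBox 1 one_pos
    have hsub := lr_submul hu hg (by positivity : (0:ℝ) < (k:ℝ) + 1) one_pos
      (by push_cast; ring : ((k + 1 : ℕ) : ℝ) + 1 = ((k:ℝ) + 1) + 1) Lk hck h0k h2k L₁ hc₁ h0₁ h2₁ L hLc hL0 hL2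
    have h1 : g L₁ = 1 / 2 :=
      lrSquare_eq_half hu hg one_pos L₁ (x₀ := 0) (y₀ := 0) (by simpa using hc₁) (by simpa using h0₁)
        (by simpa using h2₁)
    have hk := ih Lk hck h0k h2k
    have hpos : 0 ≤ g L₁ := (jointLimit_mem_Ioo hu hg L₁).1.le
    calc g L ≤ g Lk * g L₁ := hsub
      _ ≤ (1 / 2) ^ (k + 1) * (1 / 2) := by rw [h1]; exact mul_le_mul_of_nonneg_right hk (by norm_num)
      _ = (1 / 2) ^ (k + 1 + 1) := by ring

/-- **Long boxes are rarely crossed the long way, uniformly**: for every `ε > 0` there is a width `W`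
beyond which every left-to-right box value of the joint limit is at most `ε`.
[cite: BollobasRiordan2006, Ch. 3, proof of eq. (3)] -/
theorem lr_eventually_le (hu : Tendsto u atTop (𝓝[>] (0 : ℝ)))
    (hg : ∀ R : ConformalRectangle, Tendsto (fun n => bondDomainCrossingProb R (u n)) atTop (𝓝 (g R)))
    {ε : ℝ} (hε : 0 < ε) : ∃ W : ℝ, 0 < W ∧ ∀ w : ℝ, W ≤ w →
      ∀ (L : ConformalRectangle), L.carrier = (Ioo (0:ℝ) w ×ℂ Ioo (0:ℝ) 1) →
        L.arc 0 = {z : ℂ | z.re = 0 ∧ z.im ∈ Icc (0:ℝ) 1} →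
        L.arc 2 = {z : ℂ | z.re = w ∧ z.im ∈ Icc (0:ℝ) 1} → g L ≤ ε := by
  obtain ⟨k, hk⟩ := exists_pow_lt_of_lt_one hε (by norm_num : (1 / 2 : ℝ) < 1)
  refine ⟨(k:ℝ) + 1, by positivity, fun w hw L hLc hL0 hL2 => ?_⟩
  obtain ⟨Lk, hck, h0k, h2k⟩ := exists_lrBox ((k:ℝ) + 1) (by positivity)
  have h1 := lr_antitone hu hg (by positivity : (0:ℝ) < (k:ℝ) + 1) hw Lk hck h0k h2k L hLc hL0 hL2
  have h2 := lr_le_half_pow hu hg k Lk hck h0k h2k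
  have h3 : (1 / 2 : ℝ) ^ (k + 1) ≤ (1 / 2) ^ k := pow_le_pow_of_le_one (by norm_num) (by norm_num) (by omega)
  linarith

/-! ### Continuity in the width -/

/-- **The left-to-right box values of a joint limit are continuous in the width**: the box of width
`w` has the carrier and arcs of the image of the box of width `w₀` under the axis stretch
`x + iy ↦ (w/w₀) x + iy`, which moves the unit neighbourhood of the box by at most
`|w - w₀| (w₀ + 1)/w₀`, and `g` is Schramm–Smirnov continuous (`abs_sub_map_le`).
[cite: SchrammSmirnov2011, §5] -/
theorem lr_continuous (hu : Tendsto u atTop (𝓝[>] (0 : ℝ)))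
    (hg : ∀ R : ConformalRectangle, Tendsto (fun n => bondDomainCrossingProb R (u n)) atTop (𝓝 (g R)))
    {w₀ : ℝ} (hw₀ : 0 < w₀)
    (L₀ : ConformalRectangle) (hLc₀ : L₀.carrier = (Ioo (0:ℝ) w₀ ×ℂ Ioo (0:ℝ) 1))
    (hL0₀ : L₀.arc 0 = {z : ℂ | z.re = 0 ∧ z.im ∈ Icc (0:ℝ) 1})
    (hL2₀ : L₀.arc 2 = {z : ℂ | z.re = w₀ ∧ z.im ∈ Icc (0:ℝ) 1}) {ε : ℝ} (hε : 0 < ε) :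
    ∃ ρ : ℝ, 0 < ρ ∧ ∀ w : ℝ, 0 < w → |w - w₀| ≤ ρ →
      ∀ (L : ConformalRectangle), L.carrier = (Ioo (0:ℝ) w ×ℂ Ioo (0:ℝ) 1) →
        L.arc 0 = {z : ℂ | z.re = 0 ∧ z.im ∈ Icc (0:ℝ) 1} →
        L.arc 2 = {z : ℂ | z.re = w ∧ z.im ∈ Icc (0:ℝ) 1} → |g L - g L₀| ≤ ε := by
  obtain ⟨η, hη, hcont⟩ := abs_sub_map_le hu hg L₀ hε
  refine ⟨η * w₀ / (w₀ + 1), by positivity, fun w hw hρ L hLc hL0 hL2 => ?_⟩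
  set c : ℝ := w / w₀ with hcdef
  have hc0 : 0 < c := by positivity
  have hcw : c * w₀ = w := by rw [hcdef]; field_simp
  obtain ⟨A, hA⟩ := CountableApprox.exists_stretch c 1 hc0.ne' one_ne_zero
  -- images of coordinate rectangles under the stretch
  have hAimg : ∀ (S T : Set ℝ), A '' (S ×ℂ T) = ((fun x => c * x) '' S) ×ℂ T := by
    intro S T
    ext z
    simp only [mem_image, Complex.mem_reProdIm]
    constructor
    · rintro ⟨p, ⟨hp1, hp2⟩, rfl⟩
      exact ⟨⟨p.re, hp1, (hA p).1.symm⟩, by rw [(hA p).2, one_mul]; exact hp2⟩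
    · rintro ⟨⟨x, hx, hxz⟩, hz2⟩
      refine ⟨⟨x, z.im⟩, ⟨hx, hz2⟩, ?_⟩
      apply Complex.ext
      · rw [(hA _).1]; exact hxz
      · rw [(hA _).2, one_mul]
  have hc : (L₀.map A).carrier = L.carrier := by
    rw [MarkedDomain.carrier_map, hLc₀, hLc, hAimg, image_mul_left_Ioo hc0 0 w₀, mul_zero, hcw]
  have harc : ∀ t : ℝ, A '' {z : ℂ | z.re = t ∧ z.im ∈ Icc (0:ℝ) 1} = {z : ℂ | z.re = c * t ∧ z.im ∈ Icc (0:ℝ) 1} := by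
    intro t
    rw [setOf_re_eq_im_mem, setOf_re_eq_im_mem, hAimg, image_singleton]
  have h0 : (L₀.map A).arc 0 = L.arc 0 := by
    rw [MarkedDomain.arc_map, hL0₀, hL0, harc, mul_zero]
  have h2 : (L₀.map A).arc 2 = L.arc 2 := by
    rw [MarkedDomain.arc_map, hL2₀, hL2, harc, hcw]
  -- the stretch moves the unit neighbourhood of the box by at most `|c - 1| (w₀ + 1) ≤ η`
  have hclose : ∀ z ∈ Metric.cthickening 1 (closure L₀.carrier), dist (A z) z ≤ η := by
    intro z hz
    have hzre : |z.re| ≤ w₀ + 1 := by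
      have hK : IsCompact (closure L₀.carrier) := by
        rw [hLc₀, Complex.closure_reProdIm, closure_Ioo hw₀.ne, closure_Ioo (zero_ne_one' ℝ)]
        exact isCompact_Icc.reProdIm isCompact_Icc
      rw [hK.cthickening_eq_biUnion_closedBall zero_le_one, mem_iUnion₂] at hz
      obtain ⟨y, hy, hzy⟩ := hz
      rw [hLc₀, Complex.closure_reProdIm, closure_Ioo hw₀.ne, closure_Ioo (zero_ne_one' ℝ),
        Complex.mem_reProdIm, mem_Icc] at hy
      have hd : dist z y ≤ 1 := mem_closedBall.1 hzy
      have hre : |z.re - y.re| ≤ dist z y := by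
        rw [dist_eq_norm]; exact Complex.abs_re_le_norm (z - y)
      have htri : |z.re| ≤ |z.re - y.re| + |y.re| := by
        calc |z.re| = |(z.re - y.re) + y.re| := by ring_nf
          _ ≤ |z.re - y.re| + |y.re| := abs_add_le _ _
      have hy1 : |y.re| ≤ w₀ := abs_le.2 ⟨by linarith [hy.1.1], hy.1.2⟩
      linarith
    rw [dist_eq_norm]
    refine (Complex.norm_le_abs_re_add_abs_im _).trans ?_
    rw [Complex.sub_re, Complex.sub_im, (hA z).1, (hA z).2, one_mul, sub_self, abs_zero, add_zero,
      show c * z.re - z.re = (c - 1) * z.re by ring, abs_mul]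
    have hc1 : |c - 1| = |w - w₀| / w₀ := by
      rw [hcdef, show w / w₀ - 1 = (w - w₀) / w₀ by field_simp, abs_div, abs_of_pos hw₀]
    rw [hc1]
    have hρ' : |w - w₀| / w₀ * (w₀ + 1) ≤ η := by
      rw [div_mul_eq_mul_div, div_le_iff₀ hw₀]
      have := mul_le_mul_of_nonneg_right hρ (by positivity : (0:ℝ) ≤ w₀ + 1)
      calc |w - w₀| * (w₀ + 1) ≤ η * w₀ / (w₀ + 1) * (w₀ + 1) := this
        _ = η * w₀ := by field_simp
    calc |w - w₀| / w₀ * |z.re| ≤ |w - w₀| / w₀ * (w₀ + 1) :=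
          mul_le_mul_of_nonneg_left hzre (by positivity)
      _ ≤ η := hρ'
  have key := hcont A hclose
  rwa [congr hg hc h0 h2] at key

end JointLimit

/-- **Sub-goal `jointLimit_lrBox_laws` (line `registered`, lead c5; kernel facts, part 2) — the laws of
the left-to-right box values of every joint sequential limit of the bond-`ℤ²` crossing probabilities**:
for `u n → 0⁺` and `bondDomainCrossingProb R (u n) → g R` (all `R`), the values `g (L_w)` on the boxes
`(0,w) × (0,1)` crossed from the left to the right side are STRICTLY decreasing in `w`,
SUB-MULTIPLICATIVE (`g L_{w₁+w₂} ≤ g L_{w₁} g L_{w₂}`), tend to `0` as `w → ∞` uniformly, and are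
continuous in `w`. [cite: BollobasRiordan2006, Ch. 3, proof of eq. (3)] -/
theorem jointLimit_lrBox_laws : ∀ u : ℕ → ℝ, Filter.Tendsto u Filter.atTop (nhdsWithin (0 : ℝ) (Set.Ioi 0)) → ∀ g : Literature.Probability.RandomPlanarGeometry.ConformalRectangle → ℝ, (∀ R : Literature.Probability.RandomPlanarGeometry.ConformalRectangle, Filter.Tendsto (fun n => Literature.Probability.Percolation.bondDomainCrossingProb R (u n)) Filter.atTop (nhds (g R))) → (∀ w w' : ℝ, 0 < w → w < w' → ∀ L : Literature.Probability.RandomPlanarGeometry.ConformalRectangle, L.carrier = (Set.Ioo (0:ℝ) w ×ℂ Set.Ioo (0:ℝ) 1) → L.arc 0 = {z : ℂ | z.re = 0 ∧ z.im ∈ Set.Icc (0:ℝ) 1} → L.arc 2 = {z : ℂ | z.re = w ∧ z.im ∈ Set.Icc (0:ℝ) 1} → ∀ L' : Literature.Probability.RandomPlanarGeometry.ConformalRectangle, L'.carrier = (Set.Ioo (0:ℝ) w' ×ℂ Set.Ioo (0:ℝ) 1) → L'.arc 0 = {z : ℂ | z.re = 0 ∧ z.im ∈ Set.Icc (0:ℝ)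 1} → L'.arc 2 = {z : ℂ | z.re = w' ∧ z.im ∈ Set.Icc (0:ℝ) 1} → g L' < g L) ∧ (∀ w₁ w₂ : ℝ, 0 < w₁ → 0 < w₂ → ∀ L₁ : Literature.Probability.RandomPlanarGeometry.ConformalRectangle, L₁.carrier = (Set.Ioo (0:ℝ) w₁ ×ℂ Set.Ioo (0:ℝ) 1) → L₁.arc 0 = {z : ℂ | z.re = 0 ∧ z.im ∈ Set.Icc (0:ℝ) 1} → L₁.arc 2 = {z : ℂ | z.re = w₁ ∧ z.im ∈ Set.Icc (0:ℝ) 1} → ∀ L₂ : Literature.Probability.RandomPlanarGeometry.ConformalRectangle, L₂.carrier = (Set.Ioo (0:ℝ) w₂ ×ℂ Set.Ioo (0:ℝ) 1) → L₂.arc 0 = {z : ℂ | z.re = 0 ∧ z.im ∈ Set.Icc (0:ℝ) 1} → L₂.arc 2 = {z : ℂ | z.re = w₂ ∧ z.im ∈ Set.Icc (0:ℝ) 1} → ∀ L : Literature.Probability.RandomPlanarGeometry.ConformalRectangle, L.carrier = (Set.Ioo (0:ℝ) (w₁ + w₂) ×ℂ Set.Ioo (0:ℝ) 1) → L.arc 0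 = {z : ℂ | z.re = 0 ∧ z.im ∈ Set.Icc (0:ℝ) 1} → L.arc 2 = {z : ℂ | z.re = (w₁ + w₂) ∧ z.im ∈ Set.Icc (0:ℝ) 1} → g L ≤ g L₁ * g L₂) ∧ (∀ ε : ℝ, 0 < ε → ∃ W : ℝ, 0 < W ∧ ∀ w : ℝ, W ≤ w → ∀ L : Literature.Probability.RandomPlanarGeometry.ConformalRectangle, L.carrier = (Set.Ioo (0:ℝ) w ×ℂ Set.Ioo (0:ℝ) 1) → L.arc 0 = {z : ℂ | z.re = 0 ∧ z.im ∈ Set.Icc (0:ℝ) 1} → L.arc 2 = {z : ℂ | z.re = w ∧ z.im ∈ Set.Icc (0:ℝ) 1} → g L ≤ ε) ∧ (∀ w₀ : ℝ, 0 < w₀ → ∀ L₀ : Literature.Probability.RandomPlanarGeometry.ConformalRectangle, L₀.carrier = (Set.Ioo (0:ℝ) w₀ ×ℂ Set.Ioo (0:ℝ) 1) → L₀.arc 0 = {z : ℂ | z.re = 0 ∧ z.im ∈ Set.Icc (0:ℝ) 1} → L₀.arc 2 = {z : ℂ | z.re = w₀ ∧ z.im ∈ Set.Icc (0:ℝ)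 1} → ∀ ε : ℝ, 0 < ε → ∃ ρ : ℝ, 0 < ρ ∧ ∀ w : ℝ, 0 < w → |w - w₀| ≤ ρ → ∀ L : Literature.Probability.RandomPlanarGeometry.ConformalRectangle, L.carrier = (Set.Ioo (0:ℝ) w ×ℂ Set.Ioo (0:ℝ) 1) → L.arc 0 = {z : ℂ | z.re = 0 ∧ z.im ∈ Set.Icc (0:ℝ) 1} → L.arc 2 = {z : ℂ | z.re = w ∧ z.im ∈ Set.Icc (0:ℝ) 1} → |g L - g L₀| ≤ ε) := by
  intro u hu g hg
  refine ⟨?_, ?_, ?_, ?_⟩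
  · intro w w' hw hww' L hLc hL0 hL2 L' hLc' hL0' hL2'
    exact JointLimit.lr_strictAnti hu hg hw hww' L hLc hL0 hL2 L' hLc' hL0' hL2'
  · intro w₁ w₂ hw₁ hw₂ L₁ hLc₁ hL0₁ hL2₁ L₂ hLc₂ hL0₂ hL2₂ L hLc hL0 hL2
    exact JointLimit.lr_submul hu hg hw₁ hw₂ rfl L₁ hLc₁ hL0₁ hL2₁ L₂ hLc₂ hL0₂ hL2₂ L hLc hL0 hL2
  · intro ε hε
    exact JointLimit.lr_eventually_le hu hg hε
  · intro w₀ hw₀ L₀ hLc₀ hL0₀ hL2₀ ε hε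
    exact JointLimit.lr_continuous hu hg hw₀ L₀ hLc₀ hL0₀ hL2₀ hε

end Summit.CriticalPhenomena.CardyFormulaZ2.Cruxes.SubseqCardy.Birth

end
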